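import Summits.BirchSwinnertonDyer.BirchSwinnertonDyer.Theorems.ClassRecordThreeKolyvaginShaOrderDivisibleEnd
import Summits.BirchSwinnertonDyer.BirchSwinnertonDyer.Theorems.SemiOrdinaryEisensteinDescentWildKolyvaginUpperAtThreeOfThreePrimitives
import HarnessLib

/-!
# Route `SemiOrdinaryEisensteinDescent`, crux Ko `WildKolyvaginUpperAtThree` (stmt-BirchSwinnertonDyer-20480):
# the `3`-adic TOWER binder of Ko is IDLE on the McCallum road — Ko-without-tower ⟸ J-without-tower +
# {Cassels–Tate level inputs, Gross 3.7 (2), GZ86 III (3.1)} (width seat `bsd-wall-soed-p2-w2` g3,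
# `--supports stmt-BirchSwinnertonDyer-20480`)

WHY. Ko (and its research child J = `WildSigmaDivisibilityAtThree`, stmt-20760) carry the binder
`AdditiveThree.TowerSurjThree W` («`ρ_{E,3^n}` onto for every `n ≥ 1`», equivalently onto mod `9`,
p586736), and the route keeps a separate RESIDUAL crux NT `WildRankOneSurjNonTowerAtThree` (stmt-20484,
«onto mod 3 but not mod 9 ⟹ BSD₃(E)», declared XL: «without tower surjectivity Kolyvagin's Čebotarev step at
level `3^M` (`M ≥ 2`) fails and no refined index bound is in print»). The only consumer of the tower in Ko's
composition (line `birth` v3/v4: p581112 / p591367) is the Literature named fact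
`McCallum1991_padicValNat_card_sha_primary_add_le_of_globalDivisibility` (McCallum 1991 Cor. 5.6, upper half,
typed from the paper with McCallum's standing hypothesis `ρ_{E,p^∞}` onto). But the tree's DERIVATION of that
fact (cell `bsd-stepL`, `Theorems/ClassRecordThreeKolyvaginShaOrderDivisibleEnd.lean`, 2026-08-27) consumes the
tower binder ONLY at `n = 1`: x11b3-p2's Kolyvagin-descent END
`KolyvaginOrder.card_sha_primary_le_at_of_divT_frame_of_gross1991E0_of_prop37_of_localDuality` takes
`W.HasSurjectiveModNGaloisRep p` (onto MOD `p`) and nothing at level `p^M` (its Čebotarev, Weil-pairing,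
`H¹(K(E[p^M])/K, E[p^M]) = 0` and eigen-class steps are PROVED there from the mod-`p` image: `−I` lifts to
every level, and the `ℤ/p^M[G]`-submodules of `E[p^M]^r` are governed by absolute irreducibility mod `p`
alone). This file records the consequence for the route:

* §1 `mcCallumUpper_modP_of_casselsTate_of_frobeniusCongruence_of_E0` — McCallum's
  Cor. 5.6 upper half under global divisibility with ONLY `ρ̄_{E,p}` onto (the named fact's body with its tower
  binder replaced by `W.HasSurjectiveModNGaloisRep p`), from {`casselsTate_levelInputs` (every number field),
  Gross 3.7 (2), `Gross1991_heegnerPoint_sub_ratTorsion_mem_E0`} — bsd-stepL's derivation VERBATIM with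
  `htower 1 ↦ hρ`.
* §2 `upper_of_globalDivisibility_of_threePrimitives_modP` — kmc g17's / w2 g2's receptacle
  (`WildKolyvaginUpperAtThreeOfThreePrimitives.upper_of_globalDivisibility_of_threePrimitives`) with the tower
  hypothesis replaced by `ρ̄_{E,p}` onto.
* §3 `koTowerFree_of_sigmaTowerFree_of_threePrimitives` — **Ko′ ⟸ J′ + the three primitives**, where
  Ko′ / J′ are Ko / J VERBATIM with the binder `AdditiveThree.TowerSurjThree W →` DELETED (displayed statement
  shapes, not definitions or items). In particular the onto-mod-3 rows with a non-surjective `3`-adic tower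
  (Elkies' mod-9 defect, crux NT) need NO separate Kolyvagin-side mechanism: they are covered by the SAME
  argument, modulo J′ (= J asserted also off the tower — predicted by BSD exactly as J is) and the same print.
* §4 `wildKolyvaginUpperAtThree_of_sigmaTowerFree_of_threePrimitives` — Ko BY NAME ⟸ J′ + the three primitives.

The companion file `…EisensteinKernelAtThreeTowerFree.lean` re-runs the route kernel with Ko′ for Ko and WITHOUT the
NT socket. HONEST FRAMING: CONDITIONAL theorems (J′ is open research: the Σ-form refined Kolyvagin divisibility at
the additive prime `3` = Büyükboduk 2009 §4.2 Q1 ⊕ the Manin₃ shadow; the three primitives are Literature named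
facts); nothing about any curve is asserted; no definition, no named fact, no `sorry`; Ko, J, NT and BSD stay open.
References: [McCallumLMS1991] §1, §3, §5 Cor. 5.6; [GrossLMS1991] §2 Prop. 2.1, §3 Prop. 3.7 (2), §6, §9;
[GrossZagier1986] III (3.1); [MilneADT2006] I §6; [Jetchev2008] Conj. 1.3, (1) p. 812; [Elkies2006].
-/

set_option autoImplicit false
set_option linter.dupNamespace false -- `Summit.BirchSwinnertonDyer.BirchSwinnertonDyer.…` is the tree's layout (D-0017)

noncomputable section

open scoped Classical Pointwise

namespace Summit.BirchSwinnertonDyer.BirchSwinnertonDyer.Theorems.WildKolyvaginUpperAtThreeTowerFree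

open WeierstrassCurve NumberField IsDedekindDomain Field Function
  Literature.NumberTheory.EllipticCurves
  Literature.NumberTheory.EllipticCurves.KolyvaginCocycle
  Literature.NumberTheory.EllipticCurves.RingClassField
  Literature.NumberTheory.EllipticCurves.ModularForms
  Literature.NumberTheory.EllipticCurves.Rank1Residual
  Literature.NumberTheory.GaloisRepresentations
  Literature.NumberTheory.GaloisCohomology
  Summit.BirchSwinnertonDyer.Rank1Residual
  Summit.BirchSwinnertonDyer.Rank1Residual.Additive
  Summit.BirchSwinnertonDyer.Rank1Residual.X11b
  Summit.BirchSwinnertonDyer.Rank1Residual.X11b.Three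
  Summit.BirchSwinnertonDyer.BirchSwinnertonDyer.Theses.SemiOrdinaryEisensteinDescent
  Summit.BirchSwinnertonDyer.BirchSwinnertonDyer.Theorems.SchneiderFree
  Summit.BirchSwinnertonDyer.BirchSwinnertonDyer.Theorems.KolyvaginRankOneOfGross1991E0Prop37
  Summit.BirchSwinnertonDyer.BirchSwinnertonDyer.Theorems.WildKolyvaginUpperAtThreeOfThreePrimitives
open Literature.NumberTheory.EllipticCurves.GrossLMS1991 (prop37_2_frobeniusCongruence
  prop37_2_reductionCongruence prop37_2_reductionCongruence_of_frobeniusCongruence)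

/-! ## §1 McCallum 1991 Cor. 5.6 (upper half under global divisibility) with ONLY `ρ̄_{E,p}` onto -/

/-- **McCallum 1991 Cor. 5.6, upper half under global divisibility, with the image hypothesis ONTO MOD `p`
ONLY** — the body of the named fact `McCallum1991_padicValNat_card_sha_primary_add_le_of_globalDivisibility`
with its `p`-adic TOWER binder `∀ n, ρ̄_{E,p^n} onto` replaced by `W.HasSurjectiveModNGaloisRep p`:
`ord_p #Ш(E/K)[p^∞] + 2t ≤ 2·M₀` for `W` minimal non-CM, `K` imaginary quadratic Heegner with `d_K ∉ {−3,−4}`,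
`p` odd, `P = y_K` non-torsion with `p^{M₀} ∥ P`, whenever every derived Heegner point `P_n` over Zhang–Kolyvagin
primes of index `≥ s` is `p^s`-divisible for all `s ≤ t`. DERIVED from {`casselsTate_levelInputs` (every
number field), Gross 1991 Prop. 3.7 (2) in Nekovář's image-free rendering (`prop37_2_frobeniusCongruence`, read
at each frame through `prop37_2_reductionCongruence_of_frobeniusCongruence`),
`Gross1991_heegnerPoint_sub_ratTorsion_mem_E0`}: cell bsd-stepL's derivation
(`McCallum1991_padicValNat_card_sha_primary_add_le_of_globalDivisibility_of_casselsTate_of_prop37_of_E0`)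
VERBATIM — that proof used its tower binder only at `n = 1`, x11b3-p2's END
`KolyvaginOrder.card_sha_primary_le_at_of_divT_frame_of_gross1991E0_of_prop37_of_localDuality` taking the
mod-`p` image only. CONDITIONAL on the three facts; nothing booked. [cite: Nekovar2007, Prop. 4.13 (ii)]
[cite: McCallumLMS1991, §1 Theorem, §4 Cor. 4.5, §5 Lemma 5.1, Thm. 5.4, Cor. 5.6 (p. 310)]
[cite: Jetchev2008, p. 812 (1) and Cor. 1.5] [cite: GrossLMS1991, §3 Prop. 3.7 (2), §4 (4.1), §6 Prop. 6.2 (1), §9 Prop. 9.1]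
[cite: GrossZagier1986, III (3.1)] [cite: MilneADT2006, Ch. I §6, Prop. 6.9, Thm. 6.13(a)] -/
theorem mcCallumUpper_modP_of_casselsTate_of_frobeniusCongruence_of_E0
    (hCTf : ∀ (K : Type) [Field K] [NumberField K], casselsTate_levelInputs K)
    (h372 : prop37_2_frobeniusCongruence) (hE0 : Gross1991_heegnerPoint_sub_ratTorsion_mem_E0)
    (W : WeierstrassCurve ℚ) [W.IsElliptic] [W.IsGloballyMinimal] [NeZero (W.conductorNorm ℤ)]
    (hE : ¬ W.HasCM) (K : Type) [Field K] [NumberField K] (hK : IsImaginaryQuadratic K)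
    (hD3 : NumberField.discr K ≠ -3) (hD4 : NumberField.discr K ≠ -4)
    (hH : SatisfiesHeegnerHypothesis (W.conductorNorm ℤ) K)
    (p : ℕ) [Fact p.Prime] (hp2 : p ≠ 2) (hρ : W.HasSurjectiveModNGaloisRep p)
    (Dt : ModularParametrizationData W (W.conductorNorm ℤ)) (β : ℤ) (ι : K →+* ℂ)
    (d₁ : KolyvaginHeegnerData Dt β ι 1) (P : (W.baseChange K).toAffine.Point)
    (hP1 : d₁.toGeomPoints d₁.derivedPoint = toGeomPoints (W.baseChange K) P)
    (hnt : ¬ IsOfFinAddOrder P) (M₀ : ℕ)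
    (hM₀div : ∃ Q : (W.baseChange K).toAffine.Point, ((p ^ M₀ : ℕ) : ℤ) • Q = P)
    (hM₀max : ¬ ∃ Q : (W.baseChange K).toAffine.Point, ((p ^ (M₀ + 1) : ℕ) : ℤ) • Q = P)
    (t : ℕ)
    (hglob : ∀ (s : ℕ), s ≤ t → ∀ (n : ℕ) (d : KolyvaginHeegnerData Dt β ι n), Squarefree n →
      (∀ ℓ ∈ n.primeFactors, Zhang2014.IsKolyvaginPrime (W.conductorNorm ℤ) W K p ℓ ∧
        s ≤ Zhang2014.kolyvaginIndex W p ℓ) →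
      ∃ Q : (W.baseChange (ringClassField K ι n)).toAffine.Point, ((p ^ s : ℕ) : ℤ) • Q = d.derivedPoint) :
    padicValNat p (Nat.card (AddCommGroup.primaryComponent (W.baseChange K).sha p)) + 2 * t ≤ 2 * M₀ := by
  have hp : p.Prime := Fact.out
  have hD34 : NumberField.discr K ≠ -3 ∧ NumberField.discr K ≠ -4 := ⟨hD3, hD4⟩
  have hγ : prop37_2_reductionCongruence (W.conductorNorm ℤ) W K p :=
    prop37_2_reductionCongruence_of_frobeniusCongruence h372 (W.conductorNorm ℤ) W K p
  have hrec := heegnerPointOfConductor_one_galoisConj_holds (W.conductorNorm ℤ) W K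
  -- `P ↔ P(1)` on the fact's frame
  have hmapP : WeierstrassCurve.Affine.Point.map (W' := W)
      (algebraMap K (ringClassField K ι 1)).toRatAlgHom P = d₁.derivedPoint := by
    apply WeierstrassCurve.Affine.Point.map_injective (W' := W) d₁.emb.toRatAlgHom
    change d₁.toGeomPoints _ = d₁.toGeomPoints _
    rw [KolyvaginBottom.toGeomPoints_map_algebraMap d₁ P, hP1]
  -- the Heegner display of `P` on THIS frame (Shimura reciprocity at conductor `1`)
  obtain ⟨H, hHβ⟩ := exists_heegnerDatum (W.conductorNorm ℤ) hK.discr_neg d₁.dvd_sq_sub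
  have hPH : WeierstrassCurve.Affine.Point.map (W' := W) ι.toRatAlgHom P = heegnerPointComplex Dt H := by
    obtain ⟨e1, he1⟩ := hrec hK hH Dt β ι d₁ H hHβ
    have hι : ι.toRatAlgHom = (ringClassField K ι 1).subtype.toRatAlgHom.comp
        (algebraMap K (ringClassField K ι 1)).toRatAlgHom := by
      ext x
      rfl
    rw [hι, ← WeierstrassCurve.Affine.Point.map_map, hmapP, d₁.derivedPoint_one, map_sum,
      heegnerPointComplex, ← Finset.sum_coe_sort H.reps, ← Finset.sum_coe_sort d₁.S]
    exact Fintype.sum_equiv e1 _ _ fun s ↦ he1 s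
  have hHP : IsHeegnerPoint (W.conductorNorm ℤ) W K P := ⟨Dt, H, ι, hPH⟩
  have hc1 : ∀ d : KolyvaginHeegnerData Dt β ι 1,
      d.toGeomPoints d.derivedPoint = (W.baseChange K).toGeomPoints P :=
    fun d ↦ KolyvaginBottom.toGeomPoints_derivedPoint_one_eq hrec hK hH hPH d hHβ
  -- the class-form divisibility on the frame, from the global divisibility at depth `min M t`
  have hDivT : ∀ {M : ℕ} (_hM : 1 ≤ M) {n : ℕ} (_hn : Squarefree n)
      (_hKol : ∀ q ∈ n.primeFactors, IsKolyvaginPrime (W.conductorNorm ℤ) W K p q ∧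
        FrobEqFrobInfty W K (p ^ M) q)
      (d : (m : ℕ) → m ∣ n → KolyvaginHeegnerData Dt β ι m),
      ((p : ℤ) ^ (M - t)) • (d n dvd_rfl).kolyvaginClass hp M = 0 := by
    intro M hM n hn hKol d
    have hZ : ∀ ℓ ∈ n.primeFactors, Zhang2014.IsKolyvaginPrime (W.conductorNorm ℤ) W K p ℓ ∧
        min M t ≤ Zhang2014.kolyvaginIndex W p ℓ := by
      intro ℓ hℓ
      obtain ⟨⟨hℓP, hℓN, hℓD, hℓp, hprime, -⟩, hfrob⟩ := hKol ℓ hℓ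
      have hidx : M ≤ Zhang2014.kolyvaginIndex W p ℓ :=
        McCallum1991.le_kolyvaginIndex_of_frobEqFrobInfty W K hp hM hℓP hℓp hℓN hfrob
      exact ⟨⟨hℓP, hℓN, hℓD, hℓp, hprime, lt_of_lt_of_le (by omega) hidx⟩, (min_le_left _ _).trans hidx⟩
    obtain ⟨Q, hQ⟩ := hglob (min M t) (min_le_right M t) n (d n dvd_rfl) hn hZ
    set dn := d n dvd_rfl with hdn
    by_cases hadm : KolyvaginCocycle.IsAdmissible (Field.absoluteGaloisGroup K) dn.pointsSubgroup
          ((p ^ M : ℕ) : ℤ) ∧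
        dn.toGeomPoints dn.derivedPoint ∈
          KolyvaginCocycle.invPoints (Field.absoluteGaloisGroup K) dn.pointsSubgroup ((p ^ M : ℕ) : ℤ)
    swap
    · rw [KolyvaginHeegnerData.kolyvaginClass, dif_neg hadm, zsmul_zero]
    obtain ⟨hA, hP⟩ := hadm
    rw [KolyvaginHeegnerData.kolyvaginClass_of_admissible _ hp M hA hP]
    obtain ⟨Q0, hQ0⟩ := (W.baseChange K).zsmul_geomPoints_surjective_of_charZero
      (n := ((p ^ M : ℕ) : ℤ)) (by exact_mod_cast pow_ne_zero M hp.ne_zero) (dn.toGeomPoints dn.derivedPoint)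
    simp only at hQ0
    have hkP : ((p : ℤ) ^ (M - t)) • dn.toGeomPoints dn.derivedPoint ∈
        KolyvaginCocycle.invPoints (Field.absoluteGaloisGroup K) dn.pointsSubgroup ((p ^ M : ℕ) : ℤ) :=
      AddSubgroup.zsmul_mem _ hP _
    have hkQ : ((p ^ M : ℕ) : ℤ) • (((p : ℤ) ^ (M - t)) • Q0) =
        ((p : ℤ) ^ (M - t)) • dn.toGeomPoints dn.derivedPoint := by
      rw [smul_comm, hQ0]
    rw [kolyvaginClass_eq_cls hA hP hQ0, ← cls_zsmul hA _ hP hQ0 ((p : ℤ) ^ (M - t)) hkP hkQ]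
    refine cls_eq_zero_of_mem hA _ hkP hkQ ⟨dn.toGeomPoints Q, ⟨Q, rfl⟩, ?_⟩
    have hexp : M - t + min M t = M := by omega
    have hsc : ((p : ℤ) ^ (M - t)) * ((p ^ min M t : ℕ) : ℤ) = ((p ^ M : ℕ) : ℤ) := by
      push_cast
      rw [← pow_add, hexp]
    rw [← hQ, ← map_zsmul, ← map_zsmul, smul_smul, hsc]
  -- the generator `x₀` and the maximality, in the END's currency
  obtain ⟨x₀, hx₀'⟩ := hM₀div
  have hx₀ : p ^ M₀ • x₀ = P := by rw [← natCast_zsmul]; exact_mod_cast hx₀'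
  have hmax : ∀ Q : (W.baseChange K).toAffine.Point, p ^ (M₀ + 1) • Q ≠ P := fun Q hQ ↦
    hM₀max ⟨Q, by rw [← natCast_zsmul] at hQ; exact_mod_cast hQ⟩
  rcases Nat.eq_zero_or_pos M₀ with h0 | hpos
  · -- `M₀ = 0`: `Ш(E/K)[p^∞] = 0` (x11b3's annihilator END at `m = 0`) and `t = 0` (McCallum Lemma 5.1)
    subst h0
    have ht0 : t = 0 := by
      by_contra ht
      obtain ⟨Q₁, hQ₁⟩ := hglob t le_rfl 1 d₁ squarefree_one (by simp)
      have hP' : Three.Koly.PDiv d₁ p t := ⟨Q₁, hQ₁⟩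
      obtain ⟨Q, hQ⟩ := (Three.Koly.pDiv_one_iff_exists_zsmul_eq hK d₁ P hmapP p t
        (fun R hR ↦ RingClassNoTorsion.eq_zero_of_zsmul_pow_eq_zero_ringClassField W hK ι one_ne_zero
          hp hp2 hρ t R hR)).mp hP'
      refine hM₀max ⟨((p ^ (t - 1) : ℕ) : ℤ) • Q, ?_⟩
      rw [smul_smul, ← Nat.cast_mul, ← pow_add, show 0 + 1 + (t - 1) = t by omega, hQ]
    subst ht0
    have hkill := KolyvaginDischarged.pow_smul_sha_primary_eq_zero_at_of_gross1991E0_of_prop37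
      (N := W.conductorNorm ℤ) (W := W) (K := K) hp hp2 (@fun _ ↦ rfl) hE0
      hγ hE hK hD34 hH hHP hnt hρ (m := 0) hmax
    have hbot : ∀ c ∈ AddCommGroup.primaryComponent (W.baseChange K).sha p, c = 0 := by
      intro c hc
      obtain ⟨j, hj⟩ := (AddCommGroup.mem_primaryComponent).1 hc
      simpa using hkill c ⟨j, hj⟩
    have hcard : Nat.card (AddCommGroup.primaryComponent (W.baseChange K).sha p) = 1 := by
      rw [Nat.card_eq_one_iff_exists]
      exact ⟨⟨0, zero_mem _⟩, fun c ↦ Subtype.ext (hbot c.1 c.2)⟩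
    rw [hcard]
    simp
  -- `M₀ ≥ 1`: the END on the fact's frame, with the Weil pairing at level `p^{2M₀}` and the
  -- Cassels–Tate inputs from `casselsTate_levelInputs`
  haveI : NeZero (p ^ M₀) := ⟨pow_ne_zero _ hp.ne_zero⟩
  obtain ⟨c, hc1', hcc⟩ := exists_conj_of_isImaginaryQuadratic (K := K) hK
  have h2 : 2 ≤ p ^ M₀ * p ^ M₀ :=
    le_trans (le_trans hp.two_le (Nat.le_self_pow hpos.ne' p)) (Nat.le_mul_of_pos_right _ (NeZero.pos (p ^ M₀)))
  have hq : ((p ^ M₀ * p ^ M₀ : ℕ) : K) ≠ 0 := Nat.cast_ne_zero.mpr (NeZero.ne (p ^ M₀ * p ^ M₀))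
  obtain ⟨e, hμ, hadd₁, hadd₂, halt, hnd, hgal⟩ :=
    (W.baseChange K).exists_weilPairing_holds (p ^ M₀ * p ^ M₀) h2 hq
  obtain ⟨inv, hPT', hH3, hperf, hB, hPτ⟩ := hCTf K W p M₀ hp hp2 hpos c hc1' hcc e hμ hadd₁ hadd₂ hgal halt hnd
  exact (KolyvaginOrder.card_sha_primary_le_at_of_divT_frame_of_gross1991E0_of_prop37_of_localDuality W rfl hE
    hK hD34 hH hHP hnt hp hp2 hρ hE0 hγ Dt β ι d₁.dvd_sq_sub hc1 t hDivT hpos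
    hc1' hcc hx₀ hmax e hμ hadd₁ hadd₂ hgal halt hnd inv hPT' (fun v ↦ (hperf v).1.injective) hH3 hB
    hPτ).2.2.2

/-! ## §2 The co-STEP-L receptacle with ONLY `ρ̄_{E,p}` onto -/

/-- **co-STEP L at slack `s` from global divisibility to depth `ord_p ∏ c_ℓ + s` + {Cassels–Tate level
inputs, Gross 3.7 (2), GZ86 III (3.1)}, image hypothesis `ρ̄_{E,p}` onto ONLY (no `p`-adic tower).**
w2 g2's `WildKolyvaginUpperAtThreeOfThreePrimitives.upper_of_globalDivisibility_of_threePrimitives` VERBATIM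
with McCallum's Cor. 5.6 supplied by §1 at the mod-`p` image: rank one from
`mordellWeilRank_eq_one_of_gross1991E0_of_frobeniusCongruence` (kernel, modulo the two facts),
`ord_p #Ш ≤ ord_p #Ш[p^∞]` unconditionally, `p^{M₀} ∥ y_K` by Mordell–Weil, `ord_p [E(K):ℤP] = M₀`.
For `W` globally minimal, `p` odd with `ρ̄_{E,p}` onto, `K : Type` imaginary quadratic with `d_K ∉ {−3,−4}`
and the Heegner hypothesis for `N_E`, a frame `(Dt, H, ι)` with `P = y_K` non-torsion. CONDITIONAL on the
three facts and `hglob`. [cite: McCallumLMS1991, §5 Cor. 5.6 (p. 310) and Lemma 5.1 (p. 303)]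
[cite: GrossLMS1991, §1 Thm. 1.3 (1), §2 Prop. 2.1] [cite: Jetchev2008, (1) and Cor. 1.5 (p. 812)] -/
theorem upper_of_globalDivisibility_of_threePrimitives_modP
    (hCT : ∀ (K : Type) [Field K] [NumberField K], casselsTate_levelInputs K)
    (h372 : prop37_2_frobeniusCongruence) (hE0 : Gross1991_heegnerPoint_sub_ratTorsion_mem_E0)
    (W : WeierstrassCurve ℚ) [W.IsElliptic] [W.IsGloballyMinimal] [NeZero (W.conductorNorm ℤ)]
    (p : ℕ) [Fact p.Prime] (hp2 : p ≠ 2) (hsurj : W.HasSurjectiveModNGaloisRep p)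
    (K : Type) [Field K] [NumberField K] (hK : IsImaginaryQuadratic K)
    (h3 : NumberField.discr K ≠ -3) (h4 : NumberField.discr K ≠ -4)
    (hHH : SatisfiesHeegnerHypothesis (W.conductorNorm ℤ) K)
    (Dt : ModularParametrizationData W (W.conductorNorm ℤ))
    (H : HeegnerDatum (W.conductorNorm ℤ) (NumberField.discr K)) (ι : K →+* ℂ)
    (P : (W.baseChange K).toAffine.Point)
    (hP : WeierstrassCurve.Affine.Point.map ι.toRatAlgHom P = heegnerPointComplex Dt H)
    (hnt : ¬ IsOfFinAddOrder P) {s : ℕ}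
    (hglob : ∀ (s' : ℕ), s' ≤ padicValNat p W.tamagawaProduct + s →
      ∀ (n : ℕ) (d : KolyvaginHeegnerData Dt H.β ι n), Squarefree n →
        (∀ ℓ ∈ n.primeFactors, Zhang2014.IsKolyvaginPrime (W.conductorNorm ℤ) W K p ℓ ∧
          s' ≤ Zhang2014.kolyvaginIndex W p ℓ) → Koly.PDiv d p s') :
    Upper.IndexUpperBoundLeAt W p K P s := by
  have hp : p.Prime := Fact.out
  -- mod-`p` image onto, hence irreducible and non-CM
  have hCM : ¬ W.HasCM := fun hCM ↦ W.not_hasSurjectiveModNGaloisRep_of_hasCM hCM hp hp2 hsurj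
  haveI : NeZero ((p : ℕ) : ℚ) := ⟨by exact_mod_cast hp.ne_zero⟩
  have hirr : W.HasIrreducibleModPGaloisRep p :=
    hasIrreducibleModPGaloisRep_of_hasSurjectiveModNGaloisRep W p hsurj
  -- rank one (Kolyvagin Thm. A (1)) — kernel, modulo {3.7 (2), E0}
  have hrank : (W.baseChange K).mordellWeilRank = 1 :=
    (mordellWeilRank_eq_one_of_gross1991E0_of_frobeniusCongruence (W.conductorNorm ℤ) W rfl hE0 h372 hCM hK
      ⟨h3, h4⟩ hHH ⟨Dt, H, ι, hP⟩ hnt).1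
  -- no `p`-torsion in `E(K)`
  have hbot := torsionBy_eq_bot_of_isImaginaryQuadratic_of_hasIrreducibleModPGaloisRep W K hK hp hirr
  have hiv : ∀ x : (W.baseChange K).toAffine.Point, p • x = 0 → x = 0 := fun x hx ↦ by
    have hmem : x ∈ AddSubgroup.torsionBy (W.baseChange K).toAffine.Point ((p : ℕ) : ℤ) := by
      rw [mem_torsionBy_iff, natCast_zsmul]
      exact hx
    rw [hbot] at hmem
    exact hmem
  -- the conductor-`1` Kolyvagin–Heegner datum on the frame `(Dt, H.β, ι)` (Darmon 2004, Thm. 3.6)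
  obtain ⟨d₁⟩ := exists_kolyvaginHeegnerData_one
    (phi_heegnerTau_mem_singularModuliField_holds (W.conductorNorm ℤ) W K) hK Dt H.β ι H.dvd_sq_sub
  -- its bottom point is `P` in `E(K̄)` (Shimura reciprocity at conductor `1`)
  have hPd : d₁.toGeomPoints d₁.derivedPoint = toGeomPoints (W.baseChange K) P :=
    KolyvaginBottom.toGeomPoints_derivedPoint_one_eq
      (heegnerPointOfConductor_one_galoisConj_holds (W.conductorNorm ℤ) W K) hK hHH hP d₁ rfl
  -- `p^{M₀} ∥ P` (Mordell–Weil)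
  haveI : Module.Finite ℤ (W.baseChange K).toAffine.Point := (W.baseChange K).module_finite_point_holds
  obtain ⟨M₀, x₀, hx₀, hmax⟩ := exists_pow_smul_eq_and_forall_ne hnt (p := p) hp.two_le
  have hdiv : ∃ Q : (W.baseChange K).toAffine.Point, ((p ^ M₀ : ℕ) : ℤ) • Q = P :=
    ⟨x₀, by rw [natCast_zsmul]; exact hx₀⟩
  have hndiv : ¬ ∃ Q : (W.baseChange K).toAffine.Point, ((p ^ (M₀ + 1) : ℕ) : ℤ) • Q = P := by
    rintro ⟨Q, hQ⟩
    exact hmax Q (by rw [← natCast_zsmul]; exact hQ)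
  -- McCallum's Cor. 5.6, upper form at the mod-`p` image, with `t := ord_p ∏c + s`
  have hle : padicValNat p (Nat.card (AddCommGroup.primaryComponent (W.baseChange K).sha p)) +
      2 * (padicValNat p W.tamagawaProduct + s) ≤ 2 * M₀ :=
    mcCallumUpper_modP_of_casselsTate_of_frobeniusCongruence_of_E0 hCT h372 hE0 W hCM K hK h3 h4 hHH p hp2
      hsurj Dt H.β ι d₁ P hPd hnt M₀ hdiv hndiv (padicValNat p W.tamagawaProduct + s)
      (fun s' hs' n d hn hℓ ↦ hglob s' hs' n d hn hℓ)
  -- `ord_p #Ш ≤ ord_p #Ш[p^∞]` (no finiteness of `Ш` needed) and `ord_p [E(K):ℤP] = M₀`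
  have hsha := padicValNat_shaOrder_le_card_primaryComponent (W.baseChange K) p
  haveI : Finite (AddCommGroup.torsion (W.baseChange K).toAffine.Point) :=
    WeierstrassCurve.finite_torsion_point (W := W.baseChange K)
  obtain ⟨c, Q, hcQ, hcker⟩ := RankOne.exists_coord_of_mordellWeilRank_eq_one (W.baseChange K) hrank
  have hidx : padicValNat p (AddSubgroup.zmultiples P).index = M₀ :=
    Koly.padicValNat_index_zmultiples_eq_of_divisibility c Q hcQ hcker hiv P hdiv hndiv
  unfold Upper.IndexUpperBoundLeAt
  rw [hidx]
  omega

/-! ## §3 Ko WITHOUT the tower binder ⟸ J WITHOUT the tower binder + the three primitives -/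

/-- **Ko′ ⟸ J′ + {`∀ K, casselsTate_levelInputs K`, `prop37_2_frobeniusCongruence`,
`Gross1991_heegnerPoint_sub_ratTorsion_mem_E0`}**, where Ko′ (the conclusion) and J′ (the hypothesis `hJ'`)
are the route decls `WildKolyvaginUpperAtThree` (stmt-20480) and `WildSigmaDivisibilityAtThree` (stmt-20760)
VERBATIM with the binder `AdditiveThree.TowerSurjThree W →` DELETED (displayed shapes; not definitions, not
items). So on the onto-mod-`3` rows whose `3`-adic tower is NOT surjective (the habitat of the route's residual
crux NT `WildRankOneSurjNonTowerAtThree`, stmt-20484) the Kolyvagin-side socket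
`Upper.IndexUpperBoundLeAt W 3 K P (v₃ c)` holds by the SAME argument as on the tower rows, modulo J′ and the
same three named facts — no level-`3^M` image input is consumed anywhere (§1). CONDITIONAL on `hJ'` (open:
Σ-form refined Kolyvagin divisibility at the additive prime `3`, now asserted on all onto-mod-`3` rows) and the
three facts. [cite: McCallumLMS1991, §5 Cor. 5.6 (p. 310)] [cite: Jetchev2008, Conj. 1.3 and (1) (p. 812)]
[cite: GrossLMS1991, §3 Prop. 3.7 (2), §6] [cite: MilneADT2006, Ch. I §6 Thm. 6.13(a)] -/
theorem koTowerFree_of_sigmaTowerFree_of_threePrimitives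
    (hCT : ∀ (K : Type) [Field K] [NumberField K], casselsTate_levelInputs K)
    (h372 : prop37_2_frobeniusCongruence) (hE0 : Gross1991_heegnerPoint_sub_ratTorsion_mem_E0)
    (hJ' : ∀ (W : WeierstrassCurve ℚ) [W.IsElliptic] [W.IsGloballyMinimal] (N : ℕ) [NeZero N] (K : Type)
      [Field K] [NumberField K] (Dt : ModularParametrizationData W N)
      (H : HeegnerDatum N (NumberField.discr K)) (ι : K →+* ℂ) (P : (W.baseChange K).toAffine.Point),
      ClassO6 W 3 → W.HasSurjectiveModNGaloisRep 3 → W.analyticRank = 1 → W.conductorNorm ℤ = N →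
      IsImaginaryQuadratic K → SatisfiesHeegnerHypothesis N K →
      (W.quadraticTwist (NumberField.discr K : ℚ)).entireLFunction 1 ≠ 0 →
      WeierstrassCurve.Affine.Point.map ι.toRatAlgHom P = heegnerPointComplex Dt H →
      ¬ IsOfFinAddOrder P → Odd (NumberField.discr K) → NumberField.discr K ≠ -3 →
      ∀ (s' : ℕ), s' ≤ padicValNat 3 W.tamagawaProduct + padicValNat 3 Dt.c.natAbs →
        ∀ (n : ℕ) (d : KolyvaginHeegnerData Dt H.β ι n), Squarefree n →
          (∀ ℓ ∈ n.primeFactors, Zhang2014.IsKolyvaginPrime N W K 3 ℓ ∧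
            s' ≤ Zhang2014.kolyvaginIndex W 3 ℓ) → Koly.PDiv d 3 s') :
    ∀ (W : WeierstrassCurve ℚ) [W.IsElliptic] [W.IsGloballyMinimal] (N : ℕ) [NeZero N] (K : Type)
      [Field K] [NumberField K] (Dt : ModularParametrizationData W N)
      (H : HeegnerDatum N (NumberField.discr K)) (ι : K →+* ℂ) (P : (W.baseChange K).toAffine.Point),
      ClassO6 W 3 → W.HasSurjectiveModNGaloisRep 3 → W.analyticRank = 1 → W.conductorNorm ℤ = N →
      IsImaginaryQuadratic K → SatisfiesHeegnerHypothesis N K →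
      (W.quadraticTwist (NumberField.discr K : ℚ)).entireLFunction 1 ≠ 0 →
      WeierstrassCurve.Affine.Point.map ι.toRatAlgHom P = heegnerPointComplex Dt H →
      ¬ IsOfFinAddOrder P → Odd (NumberField.discr K) → NumberField.discr K ≠ -3 →
      Upper.IndexUpperBoundLeAt W 3 K P (padicValNat 3 Dt.c.natAbs) := by
  intro W _ _ N _ K _ _ Dt H ι P hO6 hsurj hr hN hK hHH hLd hP hnt hodd h3
  have hglob := hJ' W N K Dt H ι P hO6 hsurj hr hN hK hHH hLd hP hnt hodd h3
  subst hN
  haveI : Fact (Nat.Prime 3) := ⟨Nat.prime_three⟩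
  have hD : NumberField.discr K < -4 :=
    WildKolyvaginUpperAtThreeOfMinftyGe.discr_lt_neg_four_of_odd hK hodd h3 H.dvd_sq_sub
  have h4 : NumberField.discr K ≠ -4 := by omega
  exact upper_of_globalDivisibility_of_threePrimitives_modP hCT h372 hE0 W 3 (by decide) hsurj K hK h3 h4 hHH
    Dt H ι P hP hnt hglob

/-! ## §4 Ko BY NAME from J′ + the three primitives -/

/-- **Ko BY NAME ⟸ J′ (J with the tower binder deleted) + the three primitives** — §3 with the crux's own
`TowerSurjThree` binder simply not used (the tower version Ko ⟸ J + the same three facts is p591367).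
CONDITIONAL on `hJ'` and the three named facts; Ko, J and BSD stay open.
[cite: McCallumLMS1991, §5 Cor. 5.6 (p. 310)] [cite: Jetchev2008, Conj. 1.3 (p. 812)] -/
theorem wildKolyvaginUpperAtThree_of_sigmaTowerFree_of_threePrimitives
    (hCT : ∀ (K : Type) [Field K] [NumberField K], casselsTate_levelInputs K)
    (h372 : prop37_2_frobeniusCongruence) (hE0 : Gross1991_heegnerPoint_sub_ratTorsion_mem_E0)
    (hJ' : ∀ (W : WeierstrassCurve ℚ) [W.IsElliptic] [W.IsGloballyMinimal] (N : ℕ) [NeZero N] (K : Type)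
      [Field K] [NumberField K] (Dt : ModularParametrizationData W N)
      (H : HeegnerDatum N (NumberField.discr K)) (ι : K →+* ℂ) (P : (W.baseChange K).toAffine.Point),
      ClassO6 W 3 → W.HasSurjectiveModNGaloisRep 3 → W.analyticRank = 1 → W.conductorNorm ℤ = N →
      IsImaginaryQuadratic K → SatisfiesHeegnerHypothesis N K →
      (W.quadraticTwist (NumberField.discr K : ℚ)).entireLFunction 1 ≠ 0 →
      WeierstrassCurve.Affine.Point.map ι.toRatAlgHom P = heegnerPointComplex Dt H →
      ¬ IsOfFinAddOrder P → Odd (NumberField.discr K) → NumberField.discr K ≠ -3 →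
      ∀ (s' : ℕ), s' ≤ padicValNat 3 W.tamagawaProduct + padicValNat 3 Dt.c.natAbs →
        ∀ (n : ℕ) (d : KolyvaginHeegnerData Dt H.β ι n), Squarefree n →
          (∀ ℓ ∈ n.primeFactors, Zhang2014.IsKolyvaginPrime N W K 3 ℓ ∧
            s' ≤ Zhang2014.kolyvaginIndex W 3 ℓ) → Koly.PDiv d 3 s') :
    WildKolyvaginUpperAtThree := by
  intro W _ _ N _ K _ _ Dt H ι P hO6 hsurj hr hN hK hHH hLd hP hnt hodd h3 _htower
  exact koTowerFree_of_sigmaTowerFree_of_threePrimitives hCT h372 hE0 hJ' W N K Dt H ι P hO6 hsurj hr hN hK hHH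
    hLd hP hnt hodd h3

end Summit.BirchSwinnertonDyer.BirchSwinnertonDyer.Theorems.WildKolyvaginUpperAtThreeTowerFree

end
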